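import Mathlib.Data.Fintype.Sort
import Literature.NumberTheory.Automorphic.CartanDecompositionGLnPowers
import Literature.NumberTheory.Automorphic.GLReindex
import HarnessLib

/-!
# The Cartan decomposition of the standard Levi `Π_a GL_{n_a}(F)`
(sibling proof file towards `Literature.NumberTheory.Automorphic.bernsteinZelevinsky_support`)

For a block labelling `c : Fin n → Fin r` the standard Levi of `GL_n` is the product
`M = Π_a GL(B_a, F)` over the blocks `B_a = {i // c i = a}` (Bernstein–Zelevinsky 1977,
Example 2.2). This file transports the `p`-adic Cartan decomposition of the tree
(`Literature.NumberTheory.Automorphic.exists_glInt_mul_mul_eq_zpowDiagGL`, for `GL (Fin N) F`: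
`k₁ g k₂ = diag(ϖ^{a_1}, …, ϖ^{a_N})` with `a` antitone and `k₁, k₂ ∈ GL_N(𝒪)`) to `M`:

* `blockEnum c a : Fin |B_a| ≃o B_a` — the increasing enumeration of a block (Mathlib
  `monoEquivOfFin`), and `leviIntegral F c ≤ M` — the product of the groups `GL(B_a, 𝒪)`
  (`glInt` transported along `reindexGL (blockEnum c a)`), a compact open subgroup
  (`isCompact_leviIntegral`, `isOpen_leviIntegral`);
* `leviZpowDiag c hϖ e ∈ M` for `e : Fin n → ℤ` — the diagonal element `diag(ϖ^{e i})`
  (block by block), multiplicative in `e`, and central in `M` when `e` is constant on blocks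
  (`leviZpowDiag_mem_center`);
* `exists_leviIntegral_mul_leviZpowDiag_mul` (**Cartan decomposition of the Levi**): every
  `m ∈ M` is `k₁ · diag(ϖ^{e}) · k₂` with `k₁, k₂ ∈ leviIntegral F c` and `e` antitone on each
  block (Cartier, Corvallis 1979, §IV.2 for `GL_n`; the product group case is immediate). This is
  the decomposition `M = K A⁺ K` entering Harish-Chandra's proof that quasi-cuspidal
  representations have compactly supported matrix coefficients modulo the centre
  (Bernstein–Zelevinsky 1976, §3; Casselman 1995, §5–6), used here for the supercuspidal support
  (Bernstein–Zelevinsky 1977, Thm. 2.5).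

All statements proved; the definitions `blockEnum`, `leviIntegral`, `leviZpowDiag`,
`blockExponent` are real; no named facts.

## References

* P. Cartier, *Representations of 𝔭-adic groups: a survey*, Proc. Sympos. Pure Math. 33 (1979),
  part 1, §IV.2 [CartierCorvallis1979].
* I. N. Bernstein, A. V. Zelevinsky, *Induced representations of reductive `p`-adic groups I*,
  Ann. Sci. ÉNS 10 (1977), Example 2.2, Thm. 2.5 [BernsteinZelevinsky1977].
* I. N. Bernstein, A. V. Zelevinsky, *Representations of the group `GL(n, F)` where `F` is a
  non-archimedean local field*, Russian Math. Surveys 31:3 (1976), §3.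
-/

noncomputable section

open scoped MatrixGroups
open ValuativeRel

namespace Literature.NumberTheory.Automorphic

section Blocks

variable (F : Type*) [Field F] [ValuativeRel F] {n r : ℕ} (c : Fin n → Fin r)

/-- The **increasing enumeration** `Fin |B_a| ≃o B_a` of the block `B_a = {i // c i = a}`
(Mathlib `monoEquivOfFin`). [folklore] -/
def blockEnum (a : Fin r) : Fin (Fintype.card {i // c i = a}) ≃o {i // c i = a} :=
  monoEquivOfFin {i // c i = a} rfl

/-- **The maximal compact subgroup `Π_a GL(B_a, 𝒪)` of the Levi** `Π_a GL(B_a, F)`: in each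
block the group `GL_N(𝒪) = glInt N F` of `ReductiveGroupData`, transported along the increasing
enumeration of the block (`reindexGL`, `Subgroup.pi`). (Cartier, Corvallis 1979, §IV.2.)
[cite: CartierCorvallis1979, §IV.2] -/
def leviIntegral : Subgroup (Π a, GL {i // c i = a} F) :=
  Subgroup.pi Set.univ fun a =>
    (glInt (Fintype.card {i // c i = a}) F).map (reindexGL (k := F) (blockEnum c a).toEquiv).toMonoidHom

variable {F c} in
/-- Membership in `leviIntegral`: each block, pulled back along the enumeration, lies in
`GL_N(𝒪)`. [folklore] -/
lemma mem_leviIntegral_iff {k : Π a, GL {i // c i = a} F} :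
    k ∈ leviIntegral F c ↔
      ∀ a, (reindexGL (k := F) (blockEnum c a).toEquiv).symm (k a) ∈
        glInt (Fintype.card {i // c i = a}) F := by
  simp only [leviIntegral, Subgroup.mem_pi, Set.mem_univ, forall_const, Subgroup.mem_map_equiv]

variable {F c} in
/-- An element built block by block from `GL_N(𝒪)` lies in `leviIntegral`. [folklore] -/
lemma reindexGL_mem_leviIntegral {k : ∀ a, GL (Fin (Fintype.card {i // c i = a})) F}
    (hk : ∀ a, k a ∈ glInt (Fintype.card {i // c i = a}) F) :
    (fun a => reindexGL (k := F) (blockEnum c a).toEquiv (k a)) ∈ leviIntegral F c := by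
  rw [mem_leviIntegral_iff]
  intro a
  simpa using hk a

/-! ### Compactness and openness -/

variable [TopologicalSpace F] [IsNonarchimedeanLocalField F]

/-- `leviIntegral F c` is compact (a finite product of continuous images of the compact groups
`GL_N(𝒪)`, `isCompact_glInt`). [cite: CartierCorvallis1979, §IV.2] -/
theorem isCompact_leviIntegral : IsCompact (leviIntegral F c : Set (Π a, GL {i // c i = a} F)) := by
  haveI : IsTopologicalRing F := inferInstance
  rw [leviIntegral, Subgroup.coe_pi]
  refine isCompact_univ_pi fun a => ?_
  rw [Subgroup.coe_map]
  exact (isCompact_glInt _ F).image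
    (Units.continuous_map (f := (Matrix.reindexAlgEquiv F F (blockEnum c a).toEquiv).toMulEquiv.toMonoidHom)
      (continuous_id.matrix_reindex _ _))

/-- `leviIntegral F c` is open (each factor is the preimage of the open `GL_N(𝒪)`,
`isOpen_glInt`, under the continuous inverse reindexing). [cite: CartierCorvallis1979, §IV.2] -/
theorem isOpen_leviIntegral : IsOpen (leviIntegral F c : Set (Π a, GL {i // c i = a} F)) := by
  haveI : IsTopologicalRing F := inferInstance
  rw [leviIntegral, Subgroup.coe_pi]
  refine isOpen_set_pi Set.finite_univ fun a _ => ?_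
  have h : (((glInt (Fintype.card {i // c i = a}) F).map
      (reindexGL (k := F) (blockEnum c a).toEquiv).toMonoidHom : Subgroup _) : Set (GL {i // c i = a} F)) =
      (reindexGL (k := F) (blockEnum c a).toEquiv).symm ⁻¹'
        ((glInt (Fintype.card {i // c i = a}) F : Subgroup _) :
          Set (GL (Fin (Fintype.card {i // c i = a})) F)) := by
    ext g
    simp only [SetLike.mem_coe, Subgroup.mem_map_equiv, Set.mem_preimage]
  rw [h]
  exact (isOpen_glInt _ F).preimage
    (Units.continuous_map
      (f := (Matrix.reindexAlgEquiv F F (blockEnum c a).toEquiv.symm).toMulEquiv.toMonoidHom)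
      (continuous_id.matrix_reindex _ _))

end Blocks

/-! ### The diagonal elements `diag(ϖ^e)` of the Levi -/

section Torus

variable {F : Type*} [Field F] {n r : ℕ} (c : Fin n → Fin r) {ϖ : F} (hϖ : ϖ ≠ 0)

/-- The element `diag(ϖ^{e i})` of the Levi `Π_a GL(B_a, F)` attached to exponents `e : Fin n → ℤ`
(block by block, `diagonalGL` of `LinearAlgebraicGroups`). (The torus elements of the Cartan
decomposition, Cartier, Corvallis 1979, §IV.2.) [cite: CartierCorvallis1979, §IV.2] -/
def leviZpowDiag (e : Fin n → ℤ) : Π a, GL {i // c i = a} F :=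
  fun a => diagonalGL {i // c i = a} F fun i => Units.mk0 ϖ hϖ ^ e i.1

/-- The matrix of the `a`-th block of `leviZpowDiag c hϖ e` is `diag(ϖ^{e i})`. [folklore] -/
@[simp] lemma coe_leviZpowDiag_apply (e : Fin n → ℤ) (a : Fin r) :
    ((leviZpowDiag c hϖ e a : GL {i // c i = a} F) : Matrix {i // c i = a} {i // c i = a} F) =
      Matrix.diagonal fun i => ϖ ^ e i.1 := by
  rw [leviZpowDiag, coe_diagonalGL]
  congr 1
  funext i
  rw [Units.val_zpow_eq_zpow_val, Units.val_mk0]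

/-- `diag(ϖ^{e + e'}) = diag(ϖ^e) diag(ϖ^{e'})`. [folklore] -/
lemma leviZpowDiag_add (e e' : Fin n → ℤ) :
    leviZpowDiag c hϖ (e + e') = leviZpowDiag c hϖ e * leviZpowDiag c hϖ e' := by
  funext a
  rw [Pi.mul_apply, leviZpowDiag, leviZpowDiag, leviZpowDiag, ← map_mul]
  congr 1
  funext i
  rw [Pi.mul_apply, Pi.add_apply, zpow_add]

/-- `diag(ϖ^0) = 1`. [folklore] -/
lemma leviZpowDiag_zero : leviZpowDiag c hϖ (0 : Fin n → ℤ) = 1 := by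
  funext a
  rw [Pi.one_apply, leviZpowDiag]
  have h : (fun i : {i // c i = a} => Units.mk0 ϖ hϖ ^ (0 : Fin n → ℤ) i.1) = 1 := by
    funext i
    simp
  rw [h, map_one]

/-- `diag(ϖ^{-e}) = diag(ϖ^e)⁻¹`. [folklore] -/
lemma leviZpowDiag_neg (e : Fin n → ℤ) : leviZpowDiag c hϖ (-e) = (leviZpowDiag c hϖ e)⁻¹ := by
  rw [eq_inv_iff_mul_eq_one, ← leviZpowDiag_add, neg_add_cancel, leviZpowDiag_zero]

/-- **Exponents constant on blocks give central elements**: if `e i = e j` whenever `c i = c j`,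
then `diag(ϖ^e)` is a block scalar matrix, central in `Π_a GL(B_a, F)` (the centre of each
`GL(B_a, F)` contains the scalars). [folklore] -/
theorem leviZpowDiag_mem_center {e : Fin n → ℤ} (he : ∀ i j : Fin n, c i = c j → e i = e j) :
    leviZpowDiag c hϖ e ∈ Subgroup.center (Π a, GL {i // c i = a} F) := by
  rw [Subgroup.mem_center_iff]
  intro g
  funext a
  rw [Pi.mul_apply, Pi.mul_apply]
  refine Units.ext ?_
  rw [Units.val_mul, Units.val_mul, coe_leviZpowDiag_apply]
  ext i j
  rw [Matrix.mul_diagonal, Matrix.diagonal_mul, he i.1 j.1 (i.2.trans j.2.symm), mul_comm]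

end Torus

/-! ### The Cartan decomposition of the Levi -/

section Cartan

variable {F : Type*} [Field F] [ValuativeRel F] {n r : ℕ} (c : Fin n → Fin r)

/-- Exponent bookkeeping: the exponent of a global index read in the enumeration of its block.
[folklore] -/
def blockExponent (aa : ∀ a : Fin r, Fin (Fintype.card {i // c i = a}) → ℤ) (a : Fin r)
    (x : {i // c i = a}) : ℤ :=
  aa a ((blockEnum c a).symm x)

/-- `blockExponent` is compatible with rewriting the block label. [folklore] -/
lemma blockExponent_congr (aa : ∀ a : Fin r, Fin (Fintype.card {i // c i = a}) → ℤ) {a a' : Fin r}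
    (h : a = a') (x : {i // c i = a}) :
    blockExponent c aa a x = blockExponent c aa a' ⟨x.1, x.2.trans h⟩ := by
  subst h
  rfl

/-- Antitone exponents in each block give exponents which are antitone on each block of `Fin n`.
[folklore] -/
lemma blockExponent_le (aa : ∀ a : Fin r, Fin (Fintype.card {i // c i = a}) → ℤ)
    (haa : ∀ a, Antitone (aa a)) {a : Fin r} {x y : {i // c i = a}} (hxy : x ≤ y) :
    blockExponent c aa a y ≤ blockExponent c aa a x :=
  haa a ((blockEnum c a).symm.monotone hxy)

omit [ValuativeRel F] in
/-- Reindexing the diagonal `ϖ^{aa}` of `GL_N(F)` along the block enumeration gives the diagonal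
`diag(ϖ^{aa ∘ enum⁻¹})` of `GL(B_a, F)`. [folklore] -/
lemma reindexGL_zpowDiagGL {ϖ : F} (hϖ : ϖ ≠ 0) (a : Fin r)
    (aa : Fin (Fintype.card {i // c i = a}) → ℤ) :
    reindexGL (k := F) (blockEnum c a).toEquiv (zpowDiagGL hϖ aa) =
      diagonalGL {i // c i = a} F fun i => Units.mk0 ϖ hϖ ^ aa ((blockEnum c a).symm i) := by
  refine Units.ext ?_
  rw [coe_reindexGL, coe_zpowDiagGL, coe_diagonalGL, Matrix.reindex_apply,
    Matrix.submatrix_diagonal_equiv]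
  congr 1
  funext i
  simp only [Function.comp_apply, Units.val_zpow_eq_zpow_val, Units.val_mk0]
  rfl

/-- **Cartan decomposition of the Levi `Π_a GL(B_a, F)`**: over a field whose valuation ring is a
discrete valuation ring with uniformizing element `ϖ` (e.g. a non-archimedean local field), every
`m` is `k₁ · diag(ϖ^{e}) · k₂` with `k₁, k₂ ∈ Π_a GL(B_a, 𝒪)` (`leviIntegral`) and `e : Fin n → ℤ`
antitone on each block (`i ≤ j`, `c i = c j` implies `e j ≤ e i`). Block by block this is
`exists_glInt_mul_mul_eq_zpowDiagGL` (Cartier, Corvallis 1979, §IV.2, the decomposition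
`G = K A⁻ K` for `GL_N`), transported along the increasing enumerations of the blocks.
[cite: CartierCorvallis1979, §IV.2] -/
theorem exists_leviIntegral_mul_leviZpowDiag_mul [IsDiscreteValuationRing 𝒪[F]] {ϖ : F}
    (hϖ : IsUniformizingElement ϖ) (m : Π a, GL {i // c i = a} F) :
    ∃ k₁ ∈ leviIntegral F c, ∃ k₂ ∈ leviIntegral F c, ∃ e : Fin n → ℤ,
      (∀ i j : Fin n, i ≤ j → c i = c j → e j ≤ e i) ∧
        m = k₁ * leviZpowDiag c hϖ.ne_zero e * k₂ := by
  -- Cartan in each block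
  choose k₁ hk₁ k₂ hk₂ aa haa heq using fun a =>
    exists_glInt_mul_mul_eq_zpowDiagGL hϖ ((reindexGL (k := F) (blockEnum c a).toEquiv).symm (m a))
  refine ⟨fun a => reindexGL (k := F) (blockEnum c a).toEquiv (k₁ a)⁻¹,
    reindexGL_mem_leviIntegral fun a => inv_mem (hk₁ a),
    fun a => reindexGL (k := F) (blockEnum c a).toEquiv (k₂ a)⁻¹,
    reindexGL_mem_leviIntegral fun a => inv_mem (hk₂ a),
    fun i => blockExponent c aa (c i) ⟨i, rfl⟩, fun i j hij hcij => ?_, ?_⟩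
  · -- antitone on blocks
    show blockExponent c aa (c j) ⟨j, rfl⟩ ≤ blockExponent c aa (c i) ⟨i, rfl⟩
    rw [blockExponent_congr c aa hcij.symm ⟨j, rfl⟩]
    exact blockExponent_le c aa haa (x := ⟨i, rfl⟩) (y := ⟨j, hcij.symm.trans rfl⟩) hij
  · -- the decomposition, block by block
    funext a
    rw [Pi.mul_apply, Pi.mul_apply]
    have h1 : (reindexGL (k := F) (blockEnum c a).toEquiv).symm (m a) =
        (k₁ a)⁻¹ * zpowDiagGL hϖ.ne_zero (aa a) * (k₂ a)⁻¹ := by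
      rw [← heq a]; group
    have h2 : m a = reindexGL (k := F) (blockEnum c a).toEquiv
        ((k₁ a)⁻¹ * zpowDiagGL hϖ.ne_zero (aa a) * (k₂ a)⁻¹) := by
      rw [← h1, MulEquiv.apply_symm_apply]
    rw [h2, map_mul, map_mul, reindexGL_zpowDiagGL]
    congr 2
    rw [leviZpowDiag]
    congr 1
    funext i
    congr 1
    change blockExponent c aa a i = blockExponent c aa (c i.1) ⟨i.1, rfl⟩
    rw [blockExponent_congr c aa i.2 ⟨i.1, rfl⟩]

end Cartan

end Literature.NumberTheory.Automorphic
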